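import Mathlib
import HarnessLib
import Summits.QuantumFields.YangMills.Theorems.LangevinControlUVFemtoCurvatureSkewnessTreeRatioFloorKernel
import Summits.QuantumFields.YangMills.Theorems.LangevinControlUVFemtoCurvatureSkewnessTreeRatioFloorMass

/-!
# `FemtoCurvatureSkewness` — lazy-walk expansion of the transverse propagator (stub `TreeRatioFloor`, crux stmt-QuantumFields-9365)

The `(k₀,k₁)`-sliced transverse torus propagator
`F(x) = Σ_q Σ_p μ(q)/(μ(q) + k̂²(p₁) + k̂²(p₂)) cos(2π(p₁x₁ + p₂x₂)/L)` (`propF`) on `(ℤ/L)²` is expanded in lazy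
walks: with `4q(a) = 4 - k̂²(a)` one has `μ + k̂²(p₁) + k̂²(p₂) = (μ+8)(1 - 4(q(p₁)+q(p₂))/(μ+8))`, a convergent
geometric series for `μ > 0`, and `Σ_p (q(p₁)+q(p₂))^m cos(…) = L² Σ_i C(m,i) λ_i(x₁) λ_{m-i}(x₂)` by the binomial
theorem and the Fourier representation of the periodised lazy kernel `λ`.  Result (`hasSum_propF`):
`F(x) = Σ_{m ≥ 0} L² D(m) E_m(x)`, `E_m(x) = Σ_i C(m,i) 2^{-m} λ_i(x₁) λ_{m-i}(x₂)` (`lazyE`), `D(m)` the mass weights.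
Finally the two sums of the stub `TreeRatioFloor` are `F(n,0)` and `F(-n,n)` (`stubSum_axis`, `stubSum_diag`).
-/

noncomputable section

namespace Summit.QuantumFields.YangMills.Theorems.FemtoCurvatureSkewness

open Finset
open scoped BigOperators

namespace TreeRatio

variable (L : ℕ) [NeZero L]

/-- The sliced transverse propagator `F(x) = Σ_q Σ_p μ(q)/(μ(q)+k̂²(p₁)+k̂²(p₂)) cos(2π(p₁x₁+p₂x₂)/L)`. -/
def propF (x : ℤ × ℤ) : ℝ :=
  ∑ q : ZMod L × ZMod L, ∑ p : ZMod L × ZMod L,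
    mass L q / (mass L q + eps L p.1 + eps L p.2) *
      Real.cos (2 * Real.pi * ((p.1.val : ℝ) * (x.1 : ℝ) + (p.2.val : ℝ) * (x.2 : ℝ)) / L)

/-- The lazy-walk weights `E_m(x) = Σ_i C(m,i) 2^{-m} λ_i(x₁) λ_{m-i}(x₂)` (a binomial average of kernel products). -/
def lazyE (m : ℕ) (x : ℤ × ℤ) : ℝ :=
  ∑ i ∈ range (m + 1), (m.choose i : ℝ) / 2 ^ m * lam L i x.1 * lam L (m - i) x.2

omit [NeZero L] in
/-- `E_m(x) ≥ 0`. -/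
theorem lazyE_nonneg (m : ℕ) (x : ℤ × ℤ) : 0 ≤ lazyE L m x :=
  sum_nonneg fun i _ => mul_nonneg (mul_nonneg (by positivity) (lam_nonneg L i x.1)) (lam_nonneg L _ x.2)

/-! ## The binomial step -/

/-- **Binomial step**: `Σ_p (q(p₁)+q(p₂))^m cos(x₁θ_{p₁} + x₂θ_{p₂}) = L² Σ_i C(m,i) λ_i(x₁) λ_{m-i}(x₂)`. -/
theorem sum_lazyQ_add_pow_mul_cos (m : ℕ) (x : ℤ × ℤ) :
    ∑ p : ZMod L × ZMod L, (lazyQ L p.1 + lazyQ L p.2) ^ m *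
        Real.cos ((x.1 : ℝ) * (2 * Real.pi * (p.1.val : ℝ) / L) + (x.2 : ℝ) * (2 * Real.pi * (p.2.val : ℝ) / L)) =
      (L : ℝ) ^ 2 * ∑ i ∈ range (m + 1), (m.choose i : ℝ) * lam L i x.1 * lam L (m - i) x.2 := by
  -- complex form of each term
  set e : ZMod L → ℤ → ℂ := fun a y => Complex.exp ((y : ℂ) * ((2 * Real.pi * (a.val : ℝ) / L : ℝ) : ℂ) * Complex.I)
    with he
  have hterm : ∀ p : ZMod L × ZMod L, (lazyQ L p.1 + lazyQ L p.2) ^ m *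
      Real.cos ((x.1 : ℝ) * (2 * Real.pi * (p.1.val : ℝ) / L) + (x.2 : ℝ) * (2 * Real.pi * (p.2.val : ℝ) / L)) =
      ((((lazyQ L p.1 : ℝ) : ℂ) + ((lazyQ L p.2 : ℝ) : ℂ)) ^ m * (e p.1 x.1 * e p.2 x.2)).re := by
    intro p
    rw [he, ← Complex.exp_add, ← Complex.ofReal_add, ← Complex.ofReal_pow]
    have : (x.1 : ℂ) * ((2 * Real.pi * (p.1.val : ℝ) / L : ℝ) : ℂ) * Complex.I +
        (x.2 : ℂ) * ((2 * Real.pi * (p.2.val : ℝ) / L : ℝ) : ℂ) * Complex.I =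
        (((x.1 : ℝ) * (2 * Real.pi * (p.1.val : ℝ) / L) + (x.2 : ℝ) * (2 * Real.pi * (p.2.val : ℝ) / L) : ℝ) : ℂ) *
          Complex.I := by push_cast; ring
    rw [this, Complex.re_ofReal_mul, Complex.exp_ofReal_mul_I_re]
  simp_rw [hterm]
  rw [← Complex.re_sum]
  -- the complex computation
  have hC : ∑ p : ZMod L × ZMod L, (((lazyQ L p.1 : ℝ) : ℂ) + ((lazyQ L p.2 : ℝ) : ℂ)) ^ m * (e p.1 x.1 * e p.2 x.2) =
      (((L : ℝ) ^ 2 * ∑ i ∈ range (m + 1), (m.choose i : ℝ) * lam L i x.1 * lam L (m - i) x.2 : ℝ) : ℂ) := by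
    calc ∑ p : ZMod L × ZMod L, (((lazyQ L p.1 : ℝ) : ℂ) + ((lazyQ L p.2 : ℝ) : ℂ)) ^ m * (e p.1 x.1 * e p.2 x.2)
        = ∑ p : ZMod L × ZMod L, ∑ i ∈ range (m + 1),
            (m.choose i : ℂ) * ((((lazyQ L p.1 : ℝ) : ℂ)) ^ i * e p.1 x.1) *
              ((((lazyQ L p.2 : ℝ) : ℂ)) ^ (m - i) * e p.2 x.2) := by
          refine sum_congr rfl fun p _ => ?_
          rw [add_pow, sum_mul]
          refine sum_congr rfl fun i _ => ?_
          ring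
      _ = ∑ i ∈ range (m + 1), (m.choose i : ℂ) *
            ((∑ a : ZMod L, ((lazyQ L a : ℝ) : ℂ) ^ i * e a x.1) *
              ∑ a : ZMod L, ((lazyQ L a : ℝ) : ℂ) ^ (m - i) * e a x.2) := by
          rw [sum_comm]
          refine sum_congr rfl fun i _ => ?_
          rw [Finset.sum_mul_sum, Finset.mul_sum, Fintype.sum_prod_type]
          refine sum_congr rfl fun a _ => ?_
          rw [Finset.mul_sum]
          refine sum_congr rfl fun b _ => ?_
          ring
      _ = ∑ i ∈ range (m + 1), (m.choose i : ℂ) *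
            ((((L : ℝ) * lam L i (-x.1) : ℝ) : ℂ) * (((L : ℝ) * lam L (m - i) (-x.2) : ℝ) : ℂ)) := by
          refine sum_congr rfl fun i _ => ?_
          rw [he, fourier_lam L i x.1, fourier_lam L (m - i) x.2]
      _ = (((L : ℝ) ^ 2 * ∑ i ∈ range (m + 1), (m.choose i : ℝ) * lam L i x.1 * lam L (m - i) x.2 : ℝ) : ℂ) := by
          simp only [lam_neg]
          push_cast
          rw [mul_sum]
          refine sum_congr rfl fun i _ => ?_
          ring
  rw [hC, Complex.ofReal_re]

/-! ## The geometric step and the expansion -/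

omit [NeZero L] in
/-- The denominator identity: `μ + k̂²(p₁) + k̂²(p₂) = (μ + 8) - 4(q(p₁) + q(p₂))`. -/
theorem denom_eq (μ : ℝ) (p : ZMod L × ZMod L) :
    μ + eps L p.1 + eps L p.2 = (μ + 8) - 4 * (lazyQ L p.1 + lazyQ L p.2) := by
  have h1 := four_mul_lazyQ L p.1
  have h2 := four_mul_lazyQ L p.2
  simp only [eps] at *
  linarith

omit [NeZero L] in
/-- **Geometric step**: for each pair of slices, the lazy-walk series of one term of `F`. -/
theorem hasSum_term (q p : ZMod L × ZMod L) (c : ℝ) :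
    HasSum (fun m : ℕ => mass L q * c * (4 * (lazyQ L p.1 + lazyQ L p.2)) ^ m / (mass L q + 8) ^ (m + 1))
      (mass L q / (mass L q + eps L p.1 + eps L p.2) * c) := by
  have hm0 := mass_nonneg L q
  set Q : ℝ := lazyQ L p.1 + lazyQ L p.2 with hQ
  have hQ0 : 0 ≤ Q := add_nonneg (lazyQ_nonneg L p.1) (lazyQ_nonneg L p.2)
  have hQ2 : Q ≤ 2 := by have := lazyQ_le_one L p.1; have := lazyQ_le_one L p.2; linarith
  rcases hm0.eq_or_lt with h0 | hpos
  · -- massless slice: everything vanishes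
    rw [← h0]
    simp only [zero_mul, zero_div]
    exact hasSum_zero
  · set r : ℝ := 4 * Q / (mass L q + 8) with hr
    have hden : 0 < mass L q + 8 := by linarith
    have hr0 : 0 ≤ r := by positivity
    have hr1 : r < 1 := by rw [hr, div_lt_one hden]; linarith
    have hgeom := (hasSum_geometric_of_lt_one hr0 hr1).mul_left (mass L q * c / (mass L q + 8))
    have h1r : 1 - r = (mass L q + eps L p.1 + eps L p.2) / (mass L q + 8) := by
      rw [hr, denom_eq, hQ]; field_simp
    have hD : 0 < mass L q + eps L p.1 + eps L p.2 := by
      have := eps_nonneg L p.1; have := eps_nonneg L p.2; linarith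
    have key : (fun m : ℕ => mass L q * c * (4 * Q) ^ m / (mass L q + 8) ^ (m + 1)) =
        (fun m : ℕ => mass L q * c / (mass L q + 8) * r ^ m) := by
      funext m
      rw [hr, div_pow, pow_succ]
      field_simp
    have key2 : mass L q / (mass L q + eps L p.1 + eps L p.2) * c = mass L q * c / (mass L q + 8) * (1 - r)⁻¹ := by
      rw [h1r, inv_div]
      field_simp
    rw [key, key2]
    exact hgeom

/-- Identification of the `m`-th term of the expansion: `L² D(m) E_m(x) = Σ_q Σ_p μ cos(…) (4(q₁+q₂))^m/(μ+8)^{m+1}`. -/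
theorem propF_term_eq (x : ℤ × ℤ) (m : ℕ) : (L : ℝ) ^ 2 * massD L m * lazyE L m x =
    ∑ q : ZMod L × ZMod L, ∑ p : ZMod L × ZMod L,
      mass L q * Real.cos (2 * Real.pi * ((p.1.val : ℝ) * (x.1 : ℝ) + (p.2.val : ℝ) * (x.2 : ℝ)) / L) *
        (4 * (lazyQ L p.1 + lazyQ L p.2)) ^ m / (mass L q + 8) ^ (m + 1) := by
  have h4 : (8 : ℝ) ^ m = 4 ^ m * 2 ^ m := by rw [← mul_pow]; norm_num
  have hcos : ∀ p : ZMod L × ZMod L,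
      Real.cos (2 * Real.pi * ((p.1.val : ℝ) * (x.1 : ℝ) + (p.2.val : ℝ) * (x.2 : ℝ)) / L) =
        Real.cos ((x.1 : ℝ) * (2 * Real.pi * (p.1.val : ℝ) / L) + (x.2 : ℝ) * (2 * Real.pi * (p.2.val : ℝ) / L)) := by
    intro p; congr 1; ring
  calc (L : ℝ) ^ 2 * massD L m * lazyE L m x
      = ∑ q : ZMod L × ZMod L, mass L q * 4 ^ m / (mass L q + 8) ^ (m + 1) *
          ((L : ℝ) ^ 2 * ∑ i ∈ range (m + 1), (m.choose i : ℝ) * lam L i x.1 * lam L (m - i) x.2) := by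
        have hE : lazyE L m x = (∑ i ∈ range (m + 1), (m.choose i : ℝ) * lam L i x.1 * lam L (m - i) x.2) / 2 ^ m := by
          rw [lazyE, sum_div]
          refine sum_congr rfl fun i _ => ?_
          ring
        rw [hE, massD, Finset.mul_sum, Finset.sum_mul]
        refine sum_congr rfl fun q _ => ?_
        rw [h4]
        have h2 : (0 : ℝ) < 2 ^ m := by positivity
        have hq : (0 : ℝ) < (mass L q + 8) ^ (m + 1) := by have := mass_nonneg L q; positivity
        field_simp
    _ = ∑ q : ZMod L × ZMod L, ∑ p : ZMod L × ZMod L,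
          mass L q * Real.cos (2 * Real.pi * ((p.1.val : ℝ) * (x.1 : ℝ) + (p.2.val : ℝ) * (x.2 : ℝ)) / L) *
            (4 * (lazyQ L p.1 + lazyQ L p.2)) ^ m / (mass L q + 8) ^ (m + 1) := by
        refine sum_congr rfl fun q _ => ?_
        rw [← sum_lazyQ_add_pow_mul_cos L m x, mul_sum]
        refine sum_congr rfl fun p _ => ?_
        rw [hcos p, mul_pow]
        ring

/-- **The lazy-walk expansion of the transverse propagator**: `F(x) = Σ_m L² D(m) E_m(x)`. -/
theorem hasSum_propF (x : ℤ × ℤ) : HasSum (fun m : ℕ => (L : ℝ) ^ 2 * massD L m * lazyE L m x) (propF L x) := by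
  have h := hasSum_sum (s := (Finset.univ : Finset (ZMod L × ZMod L))) fun q _ =>
    hasSum_sum (s := (Finset.univ : Finset (ZMod L × ZMod L))) fun p _ =>
      hasSum_term L q p (Real.cos (2 * Real.pi * ((p.1.val : ℝ) * (x.1 : ℝ) + (p.2.val : ℝ) * (x.2 : ℝ)) / L))
  have hfun : (fun m : ℕ => (L : ℝ) ^ 2 * massD L m * lazyE L m x) =
      (fun m : ℕ => ∑ q : ZMod L × ZMod L, ∑ p : ZMod L × ZMod L,
          mass L q * Real.cos (2 * Real.pi * ((p.1.val : ℝ) * (x.1 : ℝ) + (p.2.val : ℝ) * (x.2 : ℝ)) / L) *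
            (4 * (lazyQ L p.1 + lazyQ L p.2)) ^ m / (mass L q + 8) ^ (m + 1)) := by
    funext m
    exact propF_term_eq L x m
  rw [hfun]
  exact h

/-! ## The two sums of the stub -/

/-- The transverse weight times a phase, summed over `(ℤ/L)⁴`, equals `F(x)` (re-indexing `k ↦ ((k₀,k₁),(k₂,k₃))`). -/
theorem fourSum_eq_propF (x : ℤ × ℤ) :
    ∑ k : Fin 4 → ZMod L,
      ((2 - 2 * Real.cos (2 * Real.pi * ((k 0).val : ℝ) / L)) + (2 - 2 * Real.cos (2 * Real.pi * ((k 1).val : ℝ) / L))) /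
        ((2 - 2 * Real.cos (2 * Real.pi * ((k 0).val : ℝ) / L)) + (2 - 2 * Real.cos (2 * Real.pi * ((k 1).val : ℝ) / L)) +
          (2 - 2 * Real.cos (2 * Real.pi * ((k 2).val : ℝ) / L)) + (2 - 2 * Real.cos (2 * Real.pi * ((k 3).val : ℝ) / L))) *
        Real.cos (2 * Real.pi * (((k 2).val : ℝ) * (x.1 : ℝ) + ((k 3).val : ℝ) * (x.2 : ℝ)) / L) = propF L x := by
  -- adapted from `PerpPropagator.fourSum_pos` (same file family)
  rw [propF, ← Fintype.sum_prod_type']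
  exact Fintype.sum_equiv
    (Equiv.mk (fun k : Fin 4 → ZMod L => ((k 0, k 1), (k 2, k 3)))
      (fun q : (ZMod L × ZMod L) × (ZMod L × ZMod L) => ![q.1.1, q.1.2, q.2.1, q.2.2])
      (fun k => by funext i; fin_cases i <;> rfl) (fun _ => rfl))
    _ _ (fun _ => rfl)

/-- The axis sum of the stub is `F(n, 0)`. -/
theorem stubSum_axis (n : ℕ) :
    ∑ k : Fin 4 → ZMod L,
      (if k = 0 then 0 else ((2 - 2 * Real.cos (2 * Real.pi * ((k 0).val : ℝ) / L)) + (2 - 2 * Real.cos (2 * Real.pi * ((k 1).val : ℝ) / L))) /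
        ((2 - 2 * Real.cos (2 * Real.pi * ((k 0).val : ℝ) / L)) + (2 - 2 * Real.cos (2 * Real.pi * ((k 1).val : ℝ) / L)) +
          (2 - 2 * Real.cos (2 * Real.pi * ((k 2).val : ℝ) / L)) + (2 - 2 * Real.cos (2 * Real.pi * ((k 3).val : ℝ) / L)))) *
        Real.cos (2 * Real.pi * ((k 2).val : ℝ) * n / L) = propF L ((n : ℤ), 0) := by
  rw [← fourSum_eq_propF]
  refine Finset.sum_congr rfl fun k _ => ?_
  by_cases hk : k = 0
  · subst hk; simp
  · rw [if_neg hk]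
    congr 2
    push_cast
    ring

/-- The diagonal sum of the stub is `F(-n, n)`. -/
theorem stubSum_diag (n : ℕ) :
    ∑ k : Fin 4 → ZMod L,
      (if k = 0 then 0 else ((2 - 2 * Real.cos (2 * Real.pi * ((k 0).val : ℝ) / L)) + (2 - 2 * Real.cos (2 * Real.pi * ((k 1).val : ℝ) / L))) /
        ((2 - 2 * Real.cos (2 * Real.pi * ((k 0).val : ℝ) / L)) + (2 - 2 * Real.cos (2 * Real.pi * ((k 1).val : ℝ) / L)) +
          (2 - 2 * Real.cos (2 * Real.pi * ((k 2).val : ℝ) / L)) + (2 - 2 * Real.cos (2 * Real.pi * ((k 3).val : ℝ) / L)))) *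
        Real.cos (2 * Real.pi * (((k 3).val : ℝ) - ((k 2).val : ℝ)) * n / L) = propF L (-(n : ℤ), (n : ℤ)) := by
  rw [← fourSum_eq_propF]
  refine Finset.sum_congr rfl fun k _ => ?_
  by_cases hk : k = 0
  · subst hk; simp
  · rw [if_neg hk]
    congr 2
    push_cast
    ring

end TreeRatio

/-- **Geometric step of the lazy-walk expansion** (registered sub-goal `TreeRatioGeometricStep`): the series of one term of the sliced propagator, with the masses and the lazy symbols written out. -/
theorem TreeRatioGeometricStep : ∀ (L : ℕ) (q p : ZMod L × ZMod L) (c : ℝ), HasSum (fun m : ℕ => ((2 - 2 *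
    Real.cos (2 * Real.pi * (q.1.val : ℝ) / L)) + (2 - 2 * Real.cos (2 * Real.pi * (q.2.val : ℝ) / L))) * c *
    (4 * ((1 + Real.cos (2 * Real.pi * (p.1.val : ℝ) / L)) / 2 + (1 + Real.cos (2 * Real.pi * (p.2.val : ℝ) /
    L)) / 2)) ^ m / (((2 - 2 * Real.cos (2 * Real.pi * (q.1.val : ℝ) / L)) + (2 - 2 * Real.cos (2 * Real.pi *
    (q.2.val : ℝ) / L))) + 8) ^ (m + 1)) (((2 - 2 * Real.cos (2 * Real.pi * (q.1.val : ℝ) / L)) + (2 - 2 *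
    Real.cos (2 * Real.pi * (q.2.val : ℝ) / L))) / (((2 - 2 * Real.cos (2 * Real.pi * (q.1.val : ℝ) / L)) +
    (2 - 2 * Real.cos (2 * Real.pi * (q.2.val : ℝ) / L))) + (2 - 2 * Real.cos (2 * Real.pi * (p.1.val : ℝ) /
    L)) + (2 - 2 * Real.cos (2 * Real.pi * (p.2.val : ℝ) / L))) * c) :=
  fun L q p c => TreeRatio.hasSum_term L q p c

end Summit.QuantumFields.YangMills.Theorems.FemtoCurvatureSkewness

end
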